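import Summits.ResolutionOfSingularities.ResolutionOfSingularities.Theorems.PurelyInseparableDim4ResConeLossyTiltFreeSeed
import Summits.ResolutionOfSingularities.ResolutionOfSingularities.Theorems.PurelyInseparableDim4ResConeLossyPairLedger
import Summits.ResolutionOfSingularities.ResolutionOfSingularities.Theorems.PurelyInseparableDim4BandLayers
import HarnessLib
import HarnessLib.Audit.Tags

/-!
# Purely inseparable four-folds — THE LOSE-BOTH PACKAGE of a tilt-free D∞ tail at `(p, d) = (5, 4)`: ledger,
# forced re-entry, and the instantiation of the three-polynomial legality/seed lemmas on the chain
# (K2(p) lane, SLICE C, tilt-free D∞ brick, FILE 2a; file-holder res-dim4-p-5 g4)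

[OURS · counted 0 · cell `res-dim4-pi` · K2(p) lane, slice C (desk WORDS #128 (h), #130 (b)) · seat p-5 g4.]
Nothing here proves K2(p)/K2(5), `NoIsolatedTrap p p` or resolution of singularities in dimension ≥ 4 / char. `p`.

SETTING (slice C after `…LossFreeTail.no_lossfree_tail`, idea-4's class D∞ of E2-WINDOW §D): an isolated above-floor
witnessed `Step0 5` chain with `x^{r₀} ∣ F₀`, constant shade `4` and `e_G = 2` from `k₀`, chart letters in `{a, a′}`,
TILT-FREE (`e_a, e_{a′} ∈ resVertex (c k)`: the residual cone involves only the two inert letters) and PASSIVE-FREE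
(the inert letters carry no boundary).
* §1 ledger: `chain_basics` (`o_k = r_k a + r_k a′ + 4`, pair bound `r_k a + r_k a′ ≤ 3` by
  `BandLayers.not_isIsolated_of_two_layers`, `x^r ∣ F`), `chain_translation_passive` / `chain_b_eq_single`
  (translations are pure shears `t·e_{a′}`: `…LossyPairTail.translation_forced` with the zero tilt),
  `chain_tiltFree_row` (degree-`o` monomials are `x^r` times inert quartics, `…CornerWalls.free_of_single_mem_resVertex`),
  `chain_letters_of_tiltFree` (the chart letters lie in `{a, a′}`: the step direction lies in the polar kernel = `⟨e_a, e_{a′}⟩`);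
* §2 **`loseBoth_package`** — at a step `k ≥ k₀` with chart `a` and `t = b k a′ ≠ 0`: weights `(α, β)`, `α + β = 3`;
  child `2e_a` (order `6`); the re-entry step is FORCED to be the pure corner `a′` (the floor `o = 5` kills the
  rest); grandchild `2e_a + e_{a′}`; and `(c k).F, (c (k+1)).F, (c (k+2)).F` satisfy the hypotheses of
  `…LossyTiltFreeSeed` (`…LayerBirths.coeff_step_F_chartExponent`, `…LossyPairLedger.exists_mem_support_offAxis_lt`),
  whence (D1): the degree-`8` rows of inert degree `≤ 1` of `(c k).F` vanish and the inner coefficients `j ∈ {2,3,4}`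
  of its degree-`9` inert-free row vanish, and (D2-seed): `x_a⁴x_{a′}⁴` or `x_a⁴x_{a′}⁵` is a monomial of `(c (k+2)).F`.
[cite: CossartJannsenSaito2020, Thm. 3.14, Lemma 13.2, Thm. 13.7] [cite: HauserPerlega2019PRIMS, §2 (transform D′ of D)]
bears_on: LADDER-RESOLUTION:D157-DOOR2 (res-dim4-pi · K2(p) = `RidgeBudget.NoAboveFloorTrap p p` · slice C, lossy residual,
D∞ tilt-free).  Supports stmt-ResolutionOfSingularities-16155 (helper).
-/

set_option linter.dupNamespace false -- mandated namespace of this single-conjunct summit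

noncomputable section

namespace Summit.ResolutionOfSingularities.ResolutionOfSingularities.Theorems.PIDim4

namespace ResCone

open MvPolynomial Finset
open Literature.AlgebraicGeometry.Resolution
open Literature.AlgebraicGeometry.Resolution.CentreBlowup
open Literature.AlgebraicGeometry.Resolution.Hauser2010
open Literature.AlgebraicGeometry.Resolution.HauserPerlega2019
open PointBlowup (direction)

variable {K : Type} [Field K] [CharP K 5] [DecidableEq K]

section Basics

omit [CharP K 5] in
/-- **Ledger of a tilt-free passive-free binary-cone state at `(5, 4)`**: `o = r_a + r_{a′} + 4`, the boundary is
`r_a e_a + r_{a′} e_{a′}`, the pair bound `r_a + r_{a′} ≤ 3` (two layers of total `≥ 4 = q − 1` are never isolated),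
and `x^r ∣ F`. [OURS · bookkeeping] [cite: HauserPerlega2019PRIMS, §2 (transform D′ of D)] -/
theorem chain_basics {c : ℕ → State K} (hc : ∀ k, IsIsolated 5 (c k).F ∧ Step0 5 (c k) (c (k + 1)))
    (hr0 : ∀ e ∈ (c 0).F.support, (c 0).r ≤ e) (hfloor : ∀ k, ordZero (c k).F ≠ 5) {k₀ : ℕ}
    (hshade : ∀ k, k₀ ≤ k → (c k).shade = ((4 : ℕ) : ℕ∞)) {a a' : Fin 4} (haa : a ≠ a')
    (hpass : ∀ k, k₀ ≤ k → ∀ i, i ≠ a → i ≠ a' → (c k).r i = 0) {k : ℕ} (hk : k₀ ≤ k) :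
    ∃ o : ℕ, ordZero (c k).F = o ∧ o = (c k).r a + (c k).r a' + 4 ∧ (c k).r a + (c k).r a' ≤ 3 ∧
      (c k).r = Finsupp.single a ((c k).r a) + Finsupp.single a' ((c k).r a') ∧
      (∀ e ∈ (c k).F.support, (c k).r ≤ e) ∧ 5 < o := by
  haveI : Fact (Nat.Prime 5) := ⟨by norm_num⟩
  obtain ⟨o, ho, h5o, -⟩ := chain_band 5 hc hfloor k
  have hrk : ∀ e ∈ (c k).F.support, (c k).r ≤ e := IsolatedBand.isolated_chain_forall_le hc hr0 k
  have hd := ordZero_sub_degree_eq_of_shade ho (hshade k hk)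
  have hdeg := degree_r_le ho hrk
  have hsplit := degree_eq_apply_add_apply_add_degIn haa (c k).r
  have hP : degIn ((Finset.univ.erase a).erase a') (c k).r = 0 := degIn_eq_zero_iff.mpr fun i hi =>
    hpass k hk i (Finset.ne_of_mem_erase (Finset.mem_of_mem_erase hi)) (Finset.ne_of_mem_erase hi)
  have hpair : (c k).r a + (c k).r a' ≤ 3 := by
    by_contra hbig
    exact BandLayers.not_isIsolated_of_two_layers (q := 5) (by norm_num) haa
      (fun e he => Finsupp.le_def.mp (hrk e he) a) (fun e he => Finsupp.le_def.mp (hrk e he) a') (by omega) (hc k).1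
  refine ⟨o, ho, by omega, hpair, ?_, hrk, h5o⟩
  ext i
  rw [two_apply haa]
  by_cases hia : i = a
  · rw [if_pos hia, hia]
  · rw [if_neg hia]
    by_cases hia' : i = a'
    · rw [if_pos hia', hia']
    · rw [if_neg hia', hpass k hk i hia hia']

/-- **Translations are pure shears**: on the tilt-free tail every passive translation vanishes
(`…LossyPairTail.translation_forced` with the zero tilt). [OURS] [cite: CossartJannsenSaito2020, Thm. 3.14] -/
theorem chain_translation_passive {c : ℕ → State K} {j : ℕ → Fin 4} {b : ℕ → Fin 4 → K}
    (hc : ∀ k, IsIsolated 5 (c k).F ∧ Step0 5 (c k) (c (k + 1))) (hw : FreeTail.IsWitnessedChain 5 c j b)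
    (hr0 : ∀ e ∈ (c 0).F.support, (c 0).r ≤ e) (hfloor : ∀ k, ordZero (c k).F ≠ 5) {k₀ : ℕ}
    (hshade : ∀ k, k₀ ≤ k → (c k).shade = ((4 : ℕ) : ℕ∞))
    (he : ∀ k, k₀ ≤ k → Module.finrank K (resVertex (c k)) = 2) {a a' : Fin 4} (haa : a ≠ a')
    (hletters : ∀ k, k₀ ≤ k → (j k = a ∨ j k = a'))
    (htilt : ∀ k, k₀ ≤ k → (Pi.single a 1 : Fin 4 → K) ∈ resVertex (c k) ∧
      (Pi.single a' 1 : Fin 4 → K) ∈ resVertex (c k))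
    {k : ℕ} (hk : k₀ ≤ k) {i : Fin 4} (hia : i ≠ a) (hia' : i ≠ a') : b k i = 0 := by
  haveI : Fact (Nat.Prime 5) := ⟨by norm_num⟩
  rcases hletters k hk with hja | hja'
  · have h := translation_forced 5 hc hw hr0 hfloor hshade he haa hletters hk hja (φ := 0) (ψ := 0) rfl rfl rfl rfl
      (by rw [add_zero]; exact (htilt k hk).1) (by rw [add_zero]; exact (htilt k hk).2) hia hia'
    rw [h]; simp
  · have h := translation_forced 5 hc hw hr0 hfloor hshade he haa.symm (fun k hk => (hletters k hk).symm) hk hja'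
      (φ := 0) (ψ := 0) rfl rfl rfl rfl
      (by rw [add_zero]; exact (htilt k hk).2) (by rw [add_zero]; exact (htilt k hk).1) hia' hia
    rw [h]; simp

/-- Hence at a step with chart `a` the translation IS `(b k a′)·e_{a′}`. [OURS] -/
theorem chain_b_eq_single {c : ℕ → State K} {j : ℕ → Fin 4} {b : ℕ → Fin 4 → K}
    (hc : ∀ k, IsIsolated 5 (c k).F ∧ Step0 5 (c k) (c (k + 1))) (hw : FreeTail.IsWitnessedChain 5 c j b)
    (hr0 : ∀ e ∈ (c 0).F.support, (c 0).r ≤ e) (hfloor : ∀ k, ordZero (c k).F ≠ 5) {k₀ : ℕ}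
    (hshade : ∀ k, k₀ ≤ k → (c k).shade = ((4 : ℕ) : ℕ∞))
    (he : ∀ k, k₀ ≤ k → Module.finrank K (resVertex (c k)) = 2) {a a' : Fin 4} (haa : a ≠ a')
    (hletters : ∀ k, k₀ ≤ k → (j k = a ∨ j k = a'))
    (htilt : ∀ k, k₀ ≤ k → (Pi.single a 1 : Fin 4 → K) ∈ resVertex (c k) ∧
      (Pi.single a' 1 : Fin 4 → K) ∈ resVertex (c k))
    {k : ℕ} (hk : k₀ ≤ k) (hjk : j k = a) : b k = Pi.single a' (b k a') := by
  funext i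
  by_cases hia' : i = a'
  · rw [hia', Pi.single_eq_same]
  · rw [Pi.single_eq_of_ne hia']
    by_cases hia : i = a
    · rw [hia, ← hjk]; exact (hw k).2.1
    · exact chain_translation_passive hc hw hr0 hfloor hshade he haa hletters htilt hk hia hia'

/-- **The tilt-free rows**: every monomial of `(c k).F` has degree `≥ o`, lies over `x^r`, and those of degree `o`
are `x^r` times INERT quartics (`x_a`- and `x_{a′}`-exponents exactly `r_a, r_{a′}`). [OURS]
[cite: CossartJannsenSaito2020, Def. 2.8] -/
theorem chain_tiltFree_row {c : ℕ → State K} (hc : ∀ k, IsIsolated 5 (c k).F ∧ Step0 5 (c k) (c (k + 1)))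
    (hr0 : ∀ e ∈ (c 0).F.support, (c 0).r ≤ e) {k₀ : ℕ}
    (hshade : ∀ k, k₀ ≤ k → (c k).shade = ((4 : ℕ) : ℕ∞)) {a a' : Fin 4}
    (htilt : ∀ k, k₀ ≤ k → (Pi.single a 1 : Fin 4 → K) ∈ resVertex (c k) ∧
      (Pi.single a' 1 : Fin 4 → K) ∈ resVertex (c k))
    {k : ℕ} (hk : k₀ ≤ k) {o : ℕ} (ho : ordZero (c k).F = o) {m : Fin 4 →₀ ℕ} (hm : m ∈ (c k).F.support) :
    (c k).r ≤ m ∧ o ≤ m.degree ∧ (m.degree = o → m a = (c k).r a ∧ m a' = (c k).r a') := by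
  haveI : Fact (Nat.Prime 5) := ⟨by norm_num⟩
  have hrk : ∀ e ∈ (c k).F.support, (c k).r ≤ e := IsolatedBand.isolated_chain_forall_le hc hr0 k
  have hd := ordZero_sub_degree_eq_of_shade ho (hshade k hk)
  refine ⟨hrk m hm, le_degree_of_mem_support_of_ordZero ho hm, fun hdeg => ?_⟩
  obtain ⟨ha, ha'⟩ := free_of_single_mem_resVertex 5 ho (by omega) (htilt k hk).1 (htilt k hk).2 _
    (sub_mem_support_resForm ho hrk hm hdeg)
  have h1 : (m - (c k).r) a + (c k).r a = m a := by
    rw [Finsupp.tsub_apply]; exact Nat.sub_add_cancel (Finsupp.le_def.mp (hrk m hm) a)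
  have h2 : (m - (c k).r) a' + (c k).r a' = m a' := by
    rw [Finsupp.tsub_apply]; exact Nat.sub_add_cancel (Finsupp.le_def.mp (hrk m hm) a')
  constructor <;> omega

omit [CharP K 5] in
/-- **CHART LETTERS FROM THE TILT-FREE FRAME**: since the direction of every step lies in the polar kernel
(`chain_direction_mem_resVertex`), which is the plane `⟨e_a, e_{a′}⟩` (tilt-free, `e_G = 2`), every chart letter of the
tail is `a` or `a′`. [OURS] [cite: CossartJannsenSaito2020, Thm. 3.14] -/
theorem chain_letters_of_tiltFree {c : ℕ → State K} {j : ℕ → Fin 4} {b : ℕ → Fin 4 → K}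
    (hc : ∀ k, IsIsolated 5 (c k).F ∧ Step0 5 (c k) (c (k + 1))) (hw : FreeTail.IsWitnessedChain 5 c j b)
    (hr0 : ∀ e ∈ (c 0).F.support, (c 0).r ≤ e) (hfloor : ∀ k, ordZero (c k).F ≠ 5) {k₀ : ℕ}
    (hshade : ∀ k, k₀ ≤ k → (c k).shade = ((4 : ℕ) : ℕ∞))
    (he : ∀ k, k₀ ≤ k → Module.finrank K (resVertex (c k)) = 2) {a a' : Fin 4} (haa : a ≠ a')
    (htilt : ∀ k, k₀ ≤ k → (Pi.single a 1 : Fin 4 → K) ∈ resVertex (c k) ∧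
      (Pi.single a' 1 : Fin 4 → K) ∈ resVertex (c k))
    {k : ℕ} (hk : k₀ ≤ k) : j k = a ∨ j k = a' := by
  haveI : Fact (Nat.Prime 5) := ⟨by norm_num⟩
  have hv : direction (j k) (b k) ∈ resVertex (c k) := chain_direction_mem_resVertex 5 hc hw hr0 hfloor hshade hk
  set f : Fin 2 → (Fin 4 → K) := ![(Pi.single a 1 : Fin 4 → K), Pi.single a' 1] with hf
  have hf0 : f 0 = Pi.single a 1 := rfl
  have hf1 : f 1 = Pi.single a' 1 := rfl
  have hind : LinearIndependent K f := by
    rw [hf, LinearIndependent.pair_iff]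
    intro s t hst
    have ha := congrFun hst a
    have ha' := congrFun hst a'
    simp only [Pi.add_apply, Pi.smul_apply, smul_eq_mul, Pi.single_eq_same, Pi.single_eq_of_ne haa,
      Pi.single_eq_of_ne haa.symm, mul_one, mul_zero, add_zero, zero_add, Pi.zero_apply] at ha ha'
    exact ⟨ha, ha'⟩
  have hle : Submodule.span K (Set.range f) ≤ resVertex (c k) := by
    rw [Submodule.span_le, Set.range_subset_iff]
    intro i
    fin_cases i
    · exact (htilt k hk).1
    · exact (htilt k hk).2
  have hW : Submodule.span K (Set.range f) = resVertex (c k) := by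
    apply Submodule.eq_of_le_of_finrank_le hle
    rw [finrank_span_eq_card hind, he k hk, Fintype.card_fin]
  rw [← hW, Submodule.mem_span_range_iff_exists_fun] at hv
  obtain ⟨cf, hcf⟩ := hv
  by_contra hno
  push Not at hno
  have h := congrFun hcf (j k)
  rw [direction_apply_self, Fin.sum_univ_two, Pi.add_apply, Pi.smul_apply, Pi.smul_apply, hf0, hf1,
    Pi.single_eq_of_ne hno.1, Pi.single_eq_of_ne hno.2, smul_zero, smul_zero, add_zero] at h
  exact zero_ne_one h

end Basics

section LoseBoth

/-- **THE LOSE-BOTH PACKAGE** (idea-4 E2 §D at a lose-both time, in the tree's frame).  At a step `k ≥ k₀` with chart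
`a`, translation `t = b k a′ ≠ 0` of the BOUNDARY letter `a′`: the weights are `(α, β)` with `α + β = 3`, the child is
`2e_a` (order `6`), the re-entry step is FORCED to be the pure corner `a′` (the floor `o = 5` kills every other
option) with grandchild `2e_a + e_{a′}`; and `…LossyTiltFreeSeed` applies to `(c k).F, (c (k+1)).F, (c (k+2)).F`:
(D1) the degree-`8` rows of inert degree `≤ 1` of `(c k).F` vanish, the inner coefficients `j ∈ {2, 3, 4}` of its
degree-`9` inert-free row vanish; (D2-seed) `x_a⁴x_{a′}⁴` or `x_a⁴x_{a′}⁵` is a monomial of `(c (k+2)).F`. [OURS]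
[cite: CossartJannsenSaito2020, Thm. 3.14, Lemma 13.2, Thm. 13.7] [cite: HauserPerlega2019PRIMS, §2 (transform D′ of D)] -/
theorem loseBoth_package {c : ℕ → State K} {j : ℕ → Fin 4} {b : ℕ → Fin 4 → K}
    (hc : ∀ k, IsIsolated 5 (c k).F ∧ Step0 5 (c k) (c (k + 1))) (hw : FreeTail.IsWitnessedChain 5 c j b)
    (hr0 : ∀ e ∈ (c 0).F.support, (c 0).r ≤ e) (hfloor : ∀ k, ordZero (c k).F ≠ 5) {k₀ : ℕ}
    (hshade : ∀ k, k₀ ≤ k → (c k).shade = ((4 : ℕ) : ℕ∞))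
    (he : ∀ k, k₀ ≤ k → Module.finrank K (resVertex (c k)) = 2) {a a' : Fin 4} (haa : a ≠ a')
    (hletters : ∀ k, k₀ ≤ k → (j k = a ∨ j k = a'))
    (htilt : ∀ k, k₀ ≤ k → (Pi.single a 1 : Fin 4 → K) ∈ resVertex (c k) ∧
      (Pi.single a' 1 : Fin 4 → K) ∈ resVertex (c k))
    (hpass : ∀ k, k₀ ≤ k → ∀ i, i ≠ a → i ≠ a' → (c k).r i = 0)
    {k : ℕ} (hk : k₀ ≤ k) (hjk : j k = a) (ht : b k a' ≠ 0) :
    (c k).r a + (c k).r a' = 3 ∧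
    (c (k + 2)).r = Finsupp.single a 2 + Finsupp.single a' 1 ∧
    (∀ m : Fin 4 →₀ ℕ, m.degree = 8 → degIn ((Finset.univ.erase a).erase a') m ≤ 1 → coeff m (c k).F = 0) ∧
    (∀ i, 2 ≤ i → i ≤ 4 →
      coeff ((c k).r + (Finsupp.single a (6 - i) + Finsupp.single a' i)) (c k).F = 0) ∧
    (coeff (Finsupp.single a 4 + Finsupp.single a' 4) (c (k + 2)).F ≠ 0 ∨
      coeff (Finsupp.single a 4 + Finsupp.single a' 5) (c (k + 2)).F ≠ 0) := by
  haveI : Fact (Nat.Prime 5) := ⟨by norm_num⟩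
  set P := (Finset.univ.erase a).erase a' with hP
  -- time `k`
  obtain ⟨o, ho, hosum, hpair, hrshape, hrk, h5o⟩ := chain_basics hc hr0 hfloor hshade haa hpass hk
  set α := (c k).r a with hα
  set β := (c k).r a' with hβdef
  set t := b k a' with htdef
  have hbk : b k = Pi.single a' t := chain_b_eq_single hc hw hr0 hfloor hshade he haa hletters htilt hk hjk
  have hta : (Pi.single a' t : Fin 4 → K) a = 0 := by rw [Pi.single_eq_of_ne haa]
  have hstep1 : c (k + 1) = CentreBlowup.step 5 Finset.univ a (Pi.single a' t) (c k) := by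
    rw [(hw k).2.2.2.2, hjk, hbk]
  -- time `k + 1`: the child is `2e_a`
  have hr1 : (c (k + 1)).r = Finsupp.single a (o - 5) := by
    rw [hstep1, step_r_univ 5 a hta (c k) ho hrk]
    ext i
    rw [Finsupp.coe_update, Finsupp.single_apply]
    by_cases hia : i = a
    · rw [hia, Function.update_self, if_pos rfl]
    · rw [Function.update_of_ne hia, Finsupp.filter_apply, if_neg (Ne.symm hia)]
      by_cases hia' : i = a'
      · rw [hia', Pi.single_eq_same, if_neg ht]
      · rw [Pi.single_eq_of_ne hia', if_pos rfl, hpass k hk i hia hia']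
  obtain ⟨o₁, ho₁, ho₁sum, -, -, hrk₁, h5o₁⟩ := chain_basics hc hr0 hfloor hshade haa hpass (k := k + 1) (by omega)
  have hr1a : (c (k + 1)).r a = o - 5 := by rw [hr1, Finsupp.single_eq_same]
  have hr1a' : (c (k + 1)).r a' = 0 := by rw [hr1, Finsupp.single_eq_of_ne haa.symm]
  have ho7 : o = 7 := by omega
  have hαβ : α + β = 3 := by omega
  have ho₁6 : o₁ = 6 := by omega
  -- time `k + 2`: the re-entry step is forced
  obtain ⟨o₂, ho₂, ho₂sum, -, -, hrk₂, h5o₂⟩ := chain_basics hc hr0 hfloor hshade haa hpass (k := k + 2) (by omega)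
  have hr2law := step_r_univ 5 (j (k + 1)) (hw (k + 1)).2.1 (c (k + 1)) ho₁ hrk₁
  rw [← (hw (k + 1)).2.2.2.2] at hr2law
  have hj1 : j (k + 1) = a' := by
    rcases hletters (k + 1) (by omega) with hja | hja'
    · exfalso
      have h2a : (c (k + 2)).r a = o₁ - 5 := by rw [hr2law, hja, Finsupp.coe_update, Function.update_self]
      have h2a' : (c (k + 2)).r a' = 0 := by
        rw [hr2law, hja, Finsupp.coe_update, Function.update_of_ne haa.symm, Finsupp.filter_apply, hr1a']
        split_ifs <;> rfl
      omega
    · exact hja'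
  have hb1a : b (k + 1) a = 0 := by
    by_contra hba
    have h2a' : (c (k + 2)).r a' = o₁ - 5 := by rw [hr2law, hj1, Finsupp.coe_update, Function.update_self]
    have h2a : (c (k + 2)).r a = 0 := by
      rw [hr2law, hj1, Finsupp.coe_update, Function.update_of_ne haa, Finsupp.filter_apply, if_neg hba]
    omega
  have hb1 : b (k + 1) = 0 := by
    funext i
    by_cases hia' : i = a'
    · rw [hia', ← hj1]; exact (hw (k + 1)).2.1
    · by_cases hia : i = a
      · rw [hia]; exact hb1a
      · exact chain_translation_passive hc hw hr0 hfloor hshade he haa hletters htilt (by omega) hia hia'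
  have hstep2 : c (k + 2) = CentreBlowup.step 5 Finset.univ a' 0 (c (k + 1)) := by
    rw [(hw (k + 1)).2.2.2.2, hj1, hb1]
  have hr2 : (c (k + 2)).r = Finsupp.single a 2 + Finsupp.single a' 1 := by
    ext i
    rw [hr2law, hj1, hb1, Finsupp.coe_update, two_apply haa]
    by_cases hia' : i = a'
    · rw [hia', Function.update_self, if_neg haa.symm, if_pos rfl]; omega
    · rw [Function.update_of_ne hia', Finsupp.filter_apply, if_pos (show (0 : Fin 4 → K) i = 0 from rfl), hr1,
        Finsupp.single_apply]
      by_cases hia : i = a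
      · rw [if_pos hia.symm, if_pos hia]; omega
      · rw [if_neg (Ne.symm hia), if_neg hia, if_neg hia']
  have hr2a : (c (k + 2)).r a = 2 := by rw [hr2, two_apply haa, if_pos rfl]
  have hr2a' : (c (k + 2)).r a' = 1 := by rw [hr2, two_apply haa, if_neg haa.symm, if_pos rfl]
  have ho₂7 : o₂ = 7 := by omega
  -- the hypotheses of `…LossyTiltFreeSeed`
  have hrk' : ∀ m ∈ (c k).F.support, Finsupp.single a α + Finsupp.single a' β ≤ m := fun m hm => by
    rw [hα, hβdef, ← hrshape]; exact hrk m hm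
  have hS1 : ∀ e : Fin 4 →₀ ℕ, 5 ≤ e.degree → ¬ IsPthPowerExponent 5 (chartExponent 5 Finset.univ a e) →
      coeff (chartExponent 5 Finset.univ a e) (c (k + 1)).F = coeff e (shear a (Pi.single a' t) (c k).F) := by
    intro e h5 hnp
    rw [hstep1, coeff_step_F_chartExponent 5 a hta (c k) (hw k).1 h5, if_neg hnp]
  have hS1' : ∀ e' ∈ (c (k + 1)).F.support, ¬ IsPthPowerExponent 5 e' →
      ∃ e ∈ (shear a (Pi.single a' t) (c k).F).support, chartExponent 5 Finset.univ a e = e' := by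
    intro e' he' _
    rw [hstep1] at he'
    obtain ⟨e, he, hee', -⟩ := exists_of_mem_support_step 5 a hta (c k) (hw k).1 he'
    exact ⟨e, he, hee'⟩
  have hF₁ : ∀ e' ∈ (c (k + 1)).F.support, 6 ≤ e'.degree ∧ 2 ≤ e' a := fun e' he' =>
    ⟨ho₁6 ▸ le_degree_of_mem_support_of_ordZero ho₁ he',
      by have := Finsupp.le_def.mp (hrk₁ e' he') a; rw [hr1a] at this; omega⟩
  have hF₁' : ∀ e' ∈ (c (k + 1)).F.support, 6 ≤ e'.degree := fun e' he' => (hF₁ e' he').1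
  have hS2 : ∀ e' : Fin 4 →₀ ℕ, 5 ≤ e'.degree → ¬ IsPthPowerExponent 5 (chartExponent 5 Finset.univ a' e') →
      coeff (chartExponent 5 Finset.univ a' e') (c (k + 2)).F = coeff e' (c (k + 1)).F := by
    intro e' h5 hnp
    rw [hstep2, coeff_step_F_chartExponent 5 a' rfl (c (k + 1)) (hw (k + 1)).1 h5, if_neg hnp, shear_zero]
  have hF₂ : ∀ E ∈ (c (k + 2)).F.support, 7 ≤ E.degree ∧ (E.degree = 7 → E a = 2) := by
    intro E hE
    obtain ⟨-, h7, h7eq⟩ := chain_tiltFree_row hc hr0 hshade htilt (k := k + 2) (by omega) ho₂ hE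
    exact ⟨ho₂7 ▸ h7, fun h => by rw [(h7eq (h.trans ho₂7.symm)).1, hr2a]⟩
  have hF : ∀ m ∈ (c k).F.support, Finsupp.single a α + Finsupp.single a' β ≤ m ∧ 7 ≤ m.degree ∧
      (m.degree = 7 → degIn P m = 4) := by
    intro m hm
    obtain ⟨-, h7, h7eq⟩ := chain_tiltFree_row hc hr0 hshade htilt hk ho hm
    refine ⟨hrk' m hm, ho7 ▸ h7, fun h => ?_⟩
    obtain ⟨hma, hma'⟩ := h7eq (h.trans ho7.symm)
    have hsplit := degree_eq_apply_add_apply_add_degIn haa m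
    rw [← hP] at hsplit
    omega
  have hwin : ∃ e' ∈ (c (k + 1)).F.support, degIn (Finset.univ.erase a') e' < 5 :=
    exists_mem_support_offAxis_lt 5 (hc (k + 1)).1 a'
  -- (D1) and (D2-seed)
  refine ⟨hαβ, hr2, fun m hm hκ => coeff_eq_zero_of_degree_eight haa hαβ ht hrk' hS1 hF₁' hS2 hF₂ hm hκ,
    fun i hi2 hi4 => ?_, seed_dichotomy haa hαβ ht hF hS1 hS1' hF₁ hS2 hF₂ hwin⟩
  have h := (rowNine_frobenius haa hαβ ht hrk' hS1 hF₁' hS2 hF₂).1 i (by omega)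
  rw [if_neg (by omega), if_neg (by omega), if_neg (by omega), if_neg (by omega)] at h
  rw [hrshape, h]
  ring

end LoseBoth

end ResCone

end Summit.ResolutionOfSingularities.ResolutionOfSingularities.Theorems.PIDim4

end
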